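import Summits.CriticalPhenomena.CardyFormulaZ2.Theorems.CardyBoundaryCoulombGasStripClusterRatesConfinedGlueTransfer
import Summits.CriticalPhenomena.CardyFormulaZ2.Theorems.CardyBoundaryCoulombGasStripClusterRatesConfinedOfDockedAux
import HarnessLib

/-!
# Crux `StripClusterRates` (stmt-CriticalPhenomena-13878), line two-cluster-rate-is-stationary-gap (lead c8):
registered stub `c8_confinedOfDocked` — the deterministic end surgery

Support file (`--supports stmt-CriticalPhenomena-13878`).  Width `n = 3b+2`, long block
`R' = [0, M'] × [0, n]` with `M' = M + 2(b+3)`, plain block `B = [b+3, b+3+M] × [0, n]`.  Given the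
DOCKED DATA of `B` — an open LOW path inside `B` from `(b+3, y₀)` to `(b+3+M, y₀')` (`y₀ ≤ r`,
`y₀' ≤ r'`), an open HIGH path from `(b+3, y₁)` to `(b+3+M, y₁')` (`y₁ ≥ r+1`, `y₁' ≥ r'+1`) and a
dual-open face path of `B` from the face `(b+2, r)` to the face `(b+3+M, r')` — and the two
deterministic END PATTERNS (every lattice edge of `R'` meeting a column `≤ b+2`, resp. `≥ M+b+4`, is
open except an explicit staircase of closed edges), the configuration lies in the END-CONFINED event
`F(M', b)` of the confined-gluing order transfer (`…ConfinedGlueTransfer`, same expression with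
`M := M + 2(b+3)`): the confined bottom / top open crossings and the two left fences are built in
`…ConfinedOfDockedAux` from the OPEN pattern edges; here the confined dual face crossing is "left dual
staircase + the dual path of `B` + right dual staircase", each dual step crossing one of the listed
CLOSED edges (`cod_dualCrossing`), and the stub `c8_confinedOfDocked` reads the status of every
end-zone edge off the two patterns in coordinates and assembles the five pieces.
Elementary lattice bookkeeping (Bollobás–Riordan 2006, Ch. 3; Grimmett 1999, §11.2). [folklore]
-/

noncomputable section

open MeasureTheory Filter Topology Set
open Literature.Probability.LatticeModels Literature.Probability.Percolation
open Summit.CriticalPhenomena.CardyFormulaZ2.Theorems.StripClusterRates.Negative (pOne pTwo rateSeqTwo rateSeqOne)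

namespace Summit.CriticalPhenomena.CardyFormulaZ2.Cruxes.StripClusterRates.TwoClusterRateIsStationaryGap

/-! ## The confined dual face crossing -/

/-- **The confined dual face crossing** of the long block: the left dual staircase (face row `b+1`
from the face `(-1, b+1)` to `(b+1, b+1)`, face column `b+1` to the face `(b+1, r)`, one step to the
start face `(b+2, r)` of the block's dual path), the dual path of the block, and the mirror staircase
on the right; each staircase step crosses a closed pattern edge, hence is dual-open. [folklore] -/
theorem cod_dualCrossing {b M : ℕ} {ω : BondConfig (Site 2)} (hb : 1 ≤ b) (hω : ω ⊆ (zdGraph 2).edgeSet)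
    {r r' : ℕ} (hr : r + 1 ≤ 3 * b + 2) (hr' : r' + 1 ≤ 3 * b + 2)
    (hDual : dualConfig ω ∈ openCrossing {z : Site 2 | ((b : ℤ) + 3 ≤ z 0 ∧ z 0 + 1 ≤ (b : ℤ) + 3 + M ∧ 0 ≤ z 1 ∧ z 1 + 1 ≤ 3 * (b : ℤ) + 2) ∨ z = pt ((b : ℤ) + 2) r ∨ z = pt ((b : ℤ) + 3 + M) r'} {pt ((b : ℤ) + 2) r} {pt ((b : ℤ) + 3 + M) r'})
    (hLa : ∀ x : ℤ, 0 ≤ x → x ≤ (b : ℤ) + 1 → s(pt x ((b : ℤ) + 1), pt x ((b : ℤ) + 2)) ∉ ω)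
    (hLb : ∀ t : ℤ, min (r : ℤ) ((b : ℤ) + 1) < t → t ≤ max (r : ℤ) ((b : ℤ) + 1) →
      s(pt ((b : ℤ) + 1) t, pt ((b : ℤ) + 2) t) ∉ ω)
    (hLc : s(pt ((b : ℤ) + 2) r, pt ((b : ℤ) + 2) ((r : ℤ) + 1)) ∉ ω)
    (hRa : ∀ x : ℤ, (M : ℤ) + b + 5 ≤ x → x ≤ (M : ℤ) + 2 * b + 6 → s(pt x ((b : ℤ) + 1), pt x ((b : ℤ) + 2)) ∉ ω)
    (hRb : ∀ t : ℤ, min (r' : ℤ) ((b : ℤ) + 1) < t → t ≤ max (r' : ℤ) ((b : ℤ) + 1) →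
      s(pt ((M : ℤ) + b + 4) t, pt ((M : ℤ) + b + 5) t) ∉ ω)
    (hRc : s(pt ((M : ℤ) + b + 4) r', pt ((M : ℤ) + b + 4) ((r' : ℤ) + 1)) ∉ ω) :
    ω ∈ (dualConfig ⁻¹' openCrossing {z ∈ ((· + pt (-1) 0) '' (rectangle ((M + 2 * (b + 3)) + 1) (3 * b + 1) : Set (Site 2))) | (z 0 ≤ (b : ℤ) ∨ ((M + 2 * (b + 3) : ℕ) : ℤ) ≤ z 0 + b) → (b : ℤ) + 1 ≤ z 1 ∧ z 1 ≤ 2 * (b : ℤ)} ((· + pt (-1) 0) '' (leftSide ((M + 2 * (b + 3)) + 1) (3 * b + 1) : Set (Site 2))) ((· + pt (-1) 0) '' (rightSide ((M + 2 * (b + 3)) + 1) (3 * b + 1) : Set (Site 2)))) := by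
  rw [Set.mem_preimage]
  set S : Set (Site 2) := {z ∈ ((· + pt (-1) 0) '' (rectangle ((M + 2 * (b + 3)) + 1) (3 * b + 1) : Set (Site 2))) |
    (z 0 ≤ (b : ℤ) ∨ ((M + 2 * (b + 3) : ℕ) : ℤ) ≤ z 0 + b) → (b : ℤ) + 1 ≤ z 1 ∧ z 1 ≤ 2 * (b : ℤ)} with hS
  have hmem' : ∀ z : Site 2, -1 ≤ z 0 → z 0 ≤ (M : ℤ) + 2 * b + 6 → 0 ≤ z 1 → z 1 ≤ 3 * (b : ℤ) + 1 →
      ((z 0 ≤ b ∨ (M : ℤ) + 2 * b + 6 ≤ z 0 + b) → (b : ℤ) + 1 ≤ z 1 ∧ z 1 ≤ 2 * b) → z ∈ S := by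
    intro z h0 h1 h2 h3 h4
    simp only [hS, Set.mem_setOf_eq, mem_image_rectangle_iff, Matrix.cons_val_zero, Matrix.cons_val_one,
      Matrix.cons_val_fin_one]
    omega
  have hmem : ∀ x j : ℤ, -1 ≤ x → x ≤ (M : ℤ) + 2 * b + 6 → 0 ≤ j → j ≤ 3 * (b : ℤ) + 1 →
      ((x ≤ b ∨ (M : ℤ) + 2 * b + 6 ≤ x + b) → (b : ℤ) + 1 ≤ j ∧ j ≤ 2 * b) → pt x j ∈ S :=
    fun x j h0 h1 h2 h3 h4 => hmem' (pt x j) h0 h1 h2 h3 h4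
  set ω' := dualConfig ω with hω'
  -- the left staircase
  have d₁ : ω' ∈ openConnIn S (pt (-1) ((b : ℤ) + 1)) (pt ((b : ℤ) + 1) ((b : ℤ) + 1)) :=
    cod_hrun (by omega) (fun x h0 h1 => hmem x _ h0 (by omega) (by omega) (by omega) (fun _ => by omega))
      (fun x h0 h1 => cod_dual_hstep hω rfl (by ring) (hLa (x + 1) (by omega) (by omega)))
  have d₂ : ω' ∈ openConnIn S (pt ((b : ℤ) + 1) ((b : ℤ) + 1)) (pt ((b : ℤ) + 1) r) := by
    rcases le_or_gt ((b : ℤ) + 1) r with h | h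
    · exact cod_vrun h (fun j h0 h1 => hmem _ j (by omega) (by omega) (by omega) (by omega) (fun _ => by omega))
        (fun j h0 h1 => cod_dual_vstep hω (by ring) rfl (hLb (j + 1) (by omega) (by omega)))
    · rw [openConnIn_comm]
      exact cod_vrun (le_of_lt h) (fun j h0 h1 => hmem _ j (by omega) (by omega) (by omega) (by omega) (fun _ => by omega))
        (fun j h0 h1 => cod_dual_vstep hω (by ring) rfl (hLb (j + 1) (by omega) (by omega)))
  have d₃ : ω' ∈ openConnIn S (pt ((b : ℤ) + 1) r) (pt ((b : ℤ) + 2) r) :=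
    cod_adj_h (by ring) (hmem _ _ (by omega) (by omega) (by omega) (by omega) (fun _ => by omega))
      (hmem _ _ (by omega) (by omega) (by omega) (by omega) (fun _ => by omega))
      (cod_dual_hstep hω (by ring) rfl hLc)
  -- the dual path of the block
  have d₄ : ω' ∈ openConnIn S (pt ((b : ℤ) + 2) r) (pt ((b : ℤ) + 3 + M) r') := by
    obtain ⟨x, hx, y, hy, hxy⟩ := hDual
    rw [Set.mem_singleton_iff] at hx hy
    rw [hx, hy] at hxy
    refine openConnIn_mono (fun z hz => ?_) _ _ hxy
    rcases hz with h | h | h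
    · exact hmem' z (by omega) (by omega) (by omega) (by omega) (fun _ => by omega)
    · rw [h]; exact hmem _ _ (by omega) (by omega) (by omega) (by omega) (fun _ => by omega)
    · rw [h]; exact hmem _ _ (by omega) (by omega) (by omega) (by omega) (fun _ => by omega)
  -- the right staircase
  have d₅ : ω' ∈ openConnIn S (pt ((b : ℤ) + 3 + M) r') (pt ((M : ℤ) + b + 4) r') :=
    cod_adj_h (by ring) (hmem _ _ (by omega) (by omega) (by omega) (by omega) (fun _ => by omega))
      (hmem _ _ (by omega) (by omega) (by omega) (by omega) (fun _ => by omega))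
      (cod_dual_hstep hω (by ring) rfl hRc)
  have d₆ : ω' ∈ openConnIn S (pt ((M : ℤ) + b + 4) r') (pt ((M : ℤ) + b + 4) ((b : ℤ) + 1)) := by
    rcases le_or_gt (r' : ℤ) ((b : ℤ) + 1) with h | h
    · exact cod_vrun h (fun j h0 h1 => hmem _ j (by omega) (by omega) (by omega) (by omega) (fun _ => by omega))
        (fun j h0 h1 => cod_dual_vstep hω (by ring) rfl (hRb (j + 1) (by omega) (by omega)))
    · rw [openConnIn_comm]
      exact cod_vrun (le_of_lt h) (fun j h0 h1 => hmem _ j (by omega) (by omega) (by omega) (by omega) (fun _ => by omega))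
        (fun j h0 h1 => cod_dual_vstep hω (by ring) rfl (hRb (j + 1) (by omega) (by omega)))
  have d₇ : ω' ∈ openConnIn S (pt ((M : ℤ) + b + 4) ((b : ℤ) + 1)) (pt ((M : ℤ) + 2 * b + 6) ((b : ℤ) + 1)) :=
    cod_hrun (by omega) (fun x h0 h1 => hmem x _ (by omega) h1 (by omega) (by omega) (fun _ => by omega))
      (fun x h0 h1 => cod_dual_hstep hω rfl (by ring) (hRa (x + 1) (by omega) (by omega)))
  exact ⟨pt (-1) ((b : ℤ) + 1), cod_mem_image_leftSide (by omega), pt ((M : ℤ) + 2 * b + 6) ((b : ℤ) + 1),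
    cod_mem_image_rightSide (by omega),
    PlanarDuality.openConnIn_trans (PlanarDuality.openConnIn_trans (PlanarDuality.openConnIn_trans
      (PlanarDuality.openConnIn_trans (PlanarDuality.openConnIn_trans (PlanarDuality.openConnIn_trans d₁ d₂)
      d₃) d₄) d₅) d₆) d₇⟩

/-! ## The stub -/

/-- **T2 · deterministic end surgery** (registered stub `c8_confinedOfDocked` of crux `StripClusterRates`,
line two-cluster-rate-is-stationary-gap, lead c8): the docked data of the plain block `[b+3, b+3+M] × [0, 3b+2]`
(LOW and HIGH open paths, the dual face path between them) together with the two deterministic end patterns of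
the long block `[0, M + 2(b+3)] × [0, 3b+2]` realise the end-confined event `F(M + 2(b+3), b)`: confined bottom
and top open crossings, the two left fences, and the confined dual-open face crossing.
[folklore; cite: BollobasRiordan2006, Ch. 3; GrimmettPercolation1999, §11.2] -/
theorem c8_confinedOfDocked : ∀ (b M : ℕ) (ω : BondConfig (Site 2)), 1 ≤ b → 1 ≤ M → ω ⊆ (zdGraph 2).edgeSet →
    ∀ (r r' y₀ y₀' y₁ y₁' : ℕ), r + 1 ≤ 3 * b + 2 → r' + 1 ≤ 3 * b + 2 → y₀ ≤ r → y₀' ≤ r' → r + 1 ≤ y₁ → y₁ ≤ 3 * b + 2 → r' + 1 ≤ y₁' → y₁' ≤ 3 * b + 2 →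
    ω ∈ openConnIn {z : Site 2 | (b : ℤ) + 3 ≤ z 0 ∧ z 0 ≤ (b : ℤ) + 3 + M ∧ 0 ≤ z 1 ∧ z 1 ≤ 3 * (b : ℤ) + 2} (pt ((b : ℤ) + 3) y₀) (pt ((b : ℤ) + 3 + M) y₀') →
    ω ∈ openConnIn {z : Site 2 | (b : ℤ) + 3 ≤ z 0 ∧ z 0 ≤ (b : ℤ) + 3 + M ∧ 0 ≤ z 1 ∧ z 1 ≤ 3 * (b : ℤ) + 2} (pt ((b : ℤ) + 3) y₁) (pt ((b : ℤ) + 3 + M) y₁') →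
    dualConfig ω ∈ openCrossing {z : Site 2 | ((b : ℤ) + 3 ≤ z 0 ∧ z 0 + 1 ≤ (b : ℤ) + 3 + M ∧ 0 ≤ z 1 ∧ z 1 + 1 ≤ 3 * (b : ℤ) + 2) ∨ z = pt ((b : ℤ) + 2) r ∨ z = pt ((b : ℤ) + 3 + M) r'} {pt ((b : ℤ) + 2) r} {pt ((b : ℤ) + 3 + M) r'} →
    (∀ e ∈ (zdGraph 2).edgeSet, (∀ z ∈ e, z ∈ (rectangle (M + 2 * (b + 3)) (3 * b + 2) : Set (Site 2))) → (∃ z ∈ e, z 0 ≤ (b : ℤ) + 2) →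
      (e ∈ ω ↔ ¬ ((∃ x : ℤ, 0 ≤ x ∧ x ≤ (b : ℤ) + 1 ∧ e = s(pt x ((b : ℤ) + 1), pt x ((b : ℤ) + 2))) ∨
                 (∃ t : ℤ, min (r : ℤ) ((b : ℤ) + 1) < t ∧ t ≤ max (r : ℤ) ((b : ℤ) + 1) ∧ e = s(pt ((b : ℤ) + 1) t, pt ((b : ℤ) + 2) t)) ∨
                 e = s(pt ((b : ℤ) + 2) r, pt ((b : ℤ) + 2) ((r : ℤ) + 1))))) →
    (∀ e ∈ (zdGraph 2).edgeSet, (∀ z ∈ e, z ∈ (rectangle (M + 2 * (b + 3)) (3 * b + 2) : Set (Site 2))) → (∃ z ∈ e, (M : ℤ) + b + 4 ≤ z 0) →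
      (e ∈ ω ↔ ¬ ((∃ x : ℤ, (M : ℤ) + b + 5 ≤ x ∧ x ≤ (M : ℤ) + 2 * b + 6 ∧ e = s(pt x ((b : ℤ) + 1), pt x ((b : ℤ) + 2))) ∨
                 (∃ t : ℤ, min (r' : ℤ) ((b : ℤ) + 1) < t ∧ t ≤ max (r' : ℤ) ((b : ℤ) + 1) ∧ e = s(pt ((M : ℤ) + b + 4) t, pt ((M : ℤ) + b + 5) t)) ∨
                 e = s(pt ((M : ℤ) + b + 4) r', pt ((M : ℤ) + b + 4) ((r' : ℤ) + 1))))) →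
    ω ∈ (openCrossing {z ∈ (rectangle (M + 2 * (b + 3)) (3 * b + 2) : Set (Site 2)) | (z 0 ≤ (b : ℤ) ∨ ((M + 2 * (b + 3) : ℕ) : ℤ) ≤ z 0 + b) → z 1 ≤ (b : ℤ)} (leftSide (M + 2 * (b + 3)) (3 * b + 2) : Set (Site 2)) (rightSide (M + 2 * (b + 3)) (3 * b + 2) : Set (Site 2)) ∩ tbCrossing b b ∩ openCrossing {z ∈ (rectangle (M + 2 * (b + 3)) (3 * b + 2) : Set (Site 2)) | (z 0 ≤ (b : ℤ) ∨ ((M + 2 * (b + 3) : ℕ) : ℤ) ≤ z 0 + b) → 2 * (b : ℤ) + 2 ≤ z 1} (leftSide (M + 2 * (b + 3)) (3 * b + 2) : Set (Site 2)) (rightSide (M + 2 * (b + 3)) (3 * b + 2) : Set (Site 2)) ∩ (BondConfig.relabel (sym2Equiv (Site.shift (-pt 0 (2 * (b : ℤ) + 2))))) ⁻¹' tbCrossing b b) ∩ (dualConfig ⁻¹' openCrossing {z ∈ ((· + pt (-1) 0) '' (rectangle ((M + 2 * (b + 3)) + 1) (3 * b + 1) : Set (Site 2))) | (z 0 ≤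 (b : ℤ) ∨ ((M + 2 * (b + 3) : ℕ) : ℤ) ≤ z 0 + b) → (b : ℤ) + 1 ≤ z 1 ∧ z 1 ≤ 2 * (b : ℤ)} ((· + pt (-1) 0) '' (leftSide ((M + 2 * (b + 3)) + 1) (3 * b + 1) : Set (Site 2))) ((· + pt (-1) 0) '' (rightSide ((M + 2 * (b + 3)) + 1) (3 * b + 1) : Set (Site 2)))) := by
  intro b M ω hb _ hω r r' y₀ y₀' y₁ y₁' hr hr' hy₀ hy₀' hy₁ hy₁n hy₁' hy₁'n hLow hHigh hDual hL hR
  -- the open edges of the two end zones, in coordinates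
  have hLh : ∀ x x' j : ℤ, x' = x + 1 → 0 ≤ x → x ≤ (b : ℤ) + 2 → 0 ≤ j → j ≤ 3 * (b : ℤ) + 2 →
      ¬ (x = (b : ℤ) + 1 ∧ min (r : ℤ) ((b : ℤ) + 1) < j ∧ j ≤ max (r : ℤ) ((b : ℤ) + 1)) →
      s(pt x j, pt x' j) ∈ ω := by
    intro x x' j hx h0 h1 h2 h3 hn
    refine (hL _ (cod_hedge_mem hx) (cod_edge_rect (by omega) (by omega)) (cod_exists_mem_le h1)).2 ?_
    rintro (⟨x₀, hx₀, hx₀', he⟩ | ⟨t, ht, ht', he⟩ | he) <;> rw [cod_mk_eq_iff] at he <;> omega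
  have hLv : ∀ x j j' : ℤ, j' = j + 1 → 0 ≤ x → x ≤ (b : ℤ) + 2 → 0 ≤ j → j' ≤ 3 * (b : ℤ) + 2 →
      ¬ ((x ≤ (b : ℤ) + 1 ∧ j = (b : ℤ) + 1) ∨ (x = (b : ℤ) + 2 ∧ j = (r : ℤ))) → s(pt x j, pt x j') ∈ ω := by
    intro x j j' hj h0 h1 h2 h3 hn
    refine (hL _ (cod_vedge_mem hj) (cod_edge_rect (by omega) (by omega)) (cod_exists_mem_le h1)).2 ?_
    rintro (⟨x₀, hx₀, hx₀', he⟩ | ⟨t, ht, ht', he⟩ | he) <;> rw [cod_mk_eq_iff] at he <;> omega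
  have hRh : ∀ x x' j : ℤ, x' = x + 1 → (M : ℤ) + b + 3 ≤ x → x' ≤ (M : ℤ) + 2 * b + 6 → 0 ≤ j →
      j ≤ 3 * (b : ℤ) + 2 →
      ¬ (x = (M : ℤ) + b + 4 ∧ min (r' : ℤ) ((b : ℤ) + 1) < j ∧ j ≤ max (r' : ℤ) ((b : ℤ) + 1)) →
      s(pt x j, pt x' j) ∈ ω := by
    intro x x' j hx h0 h1 h2 h3 hn
    refine (hR _ (cod_hedge_mem hx) (cod_edge_rect (by omega) (by omega)) (cod_exists_mem_ge (by omega))).2 ?_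
    rintro (⟨x₀, hx₀, hx₀', he⟩ | ⟨t, ht, ht', he⟩ | he) <;> rw [cod_mk_eq_iff] at he <;> omega
  have hRv : ∀ x j j' : ℤ, j' = j + 1 → (M : ℤ) + b + 4 ≤ x → x ≤ (M : ℤ) + 2 * b + 6 → 0 ≤ j →
      j' ≤ 3 * (b : ℤ) + 2 →
      ¬ (((M : ℤ) + b + 5 ≤ x ∧ j = (b : ℤ) + 1) ∨ (x = (M : ℤ) + b + 4 ∧ j = (r' : ℤ))) →
      s(pt x j, pt x j') ∈ ω := by
    intro x j j' hj h0 h1 h2 h3 hn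
    refine (hR _ (cod_vedge_mem hj) (cod_edge_rect (by omega) (by omega)) (cod_exists_mem_ge h0)).2 ?_
    rintro (⟨x₀, hx₀, hx₀', he⟩ | ⟨t, ht, ht', he⟩ | he) <;> rw [cod_mk_eq_iff] at he <;> omega
  -- the closed edges of the two end zones
  have hLa : ∀ x : ℤ, 0 ≤ x → x ≤ (b : ℤ) + 1 → s(pt x ((b : ℤ) + 1), pt x ((b : ℤ) + 2)) ∉ ω :=
    fun x h0 h1 hin => (hL _ (cod_vedge_mem (by ring)) (cod_edge_rect (by omega) (by omega))
      (cod_exists_mem_le (by omega))).1 hin (Or.inl ⟨x, h0, h1, rfl⟩)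
  have hLb : ∀ t : ℤ, min (r : ℤ) ((b : ℤ) + 1) < t → t ≤ max (r : ℤ) ((b : ℤ) + 1) →
      s(pt ((b : ℤ) + 1) t, pt ((b : ℤ) + 2) t) ∉ ω :=
    fun t h0 h1 hin => (hL _ (cod_hedge_mem (by ring)) (cod_edge_rect (by omega) (by omega))
      (cod_exists_mem_le (by omega))).1 hin (Or.inr (Or.inl ⟨t, h0, h1, rfl⟩))
  have hLc : s(pt ((b : ℤ) + 2) r, pt ((b : ℤ) + 2) ((r : ℤ) + 1)) ∉ ω :=
    fun hin => (hL _ (cod_vedge_mem rfl) (cod_edge_rect (by omega) (by omega))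
      (cod_exists_mem_le le_rfl)).1 hin (Or.inr (Or.inr rfl))
  have hRa : ∀ x : ℤ, (M : ℤ) + b + 5 ≤ x → x ≤ (M : ℤ) + 2 * b + 6 →
      s(pt x ((b : ℤ) + 1), pt x ((b : ℤ) + 2)) ∉ ω :=
    fun x h0 h1 hin => (hR _ (cod_vedge_mem (by ring)) (cod_edge_rect (by omega) (by omega))
      (cod_exists_mem_ge (by omega))).1 hin (Or.inl ⟨x, h0, h1, rfl⟩)
  have hRb : ∀ t : ℤ, min (r' : ℤ) ((b : ℤ) + 1) < t → t ≤ max (r' : ℤ) ((b : ℤ) + 1) →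
      s(pt ((M : ℤ) + b + 4) t, pt ((M : ℤ) + b + 5) t) ∉ ω :=
    fun t h0 h1 hin => (hR _ (cod_hedge_mem (by ring)) (cod_edge_rect (by omega) (by omega))
      (cod_exists_mem_ge (by omega))).1 hin (Or.inr (Or.inl ⟨t, h0, h1, rfl⟩))
  have hRc : s(pt ((M : ℤ) + b + 4) r', pt ((M : ℤ) + b + 4) ((r' : ℤ) + 1)) ∉ ω :=
    fun hin => (hR _ (cod_vedge_mem rfl) (cod_edge_rect (by omega) (by omega))
      (cod_exists_mem_ge le_rfl)).1 hin (Or.inr (Or.inr rfl))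
  exact ⟨⟨⟨⟨cod_confinedBottom b M ω r r' y₀ y₀' hr hr' hy₀ hy₀' hLow hLh hLv hRh hRv,
    cod_fenceBottom fun j h0 h1 => hLv 0 j (j + 1) rfl le_rfl (by omega) h0 (by omega) (by omega)⟩,
    cod_confinedTop b M ω r r' y₁ y₁' hy₁ hy₁n hy₁' hy₁'n hHigh hLh hLv hRh hRv⟩,
    cod_fenceTop fun j h0 h1 => hLv 0 j (j + 1) rfl le_rfl (by omega) (by omega) h1 (by omega)⟩,
    cod_dualCrossing hb hω hr hr' hDual hLa hLb hLc hRa hRb hRc⟩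

end Summit.CriticalPhenomena.CardyFormulaZ2.Cruxes.StripClusterRates.TwoClusterRateIsStationaryGap

end
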